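import Mathlib
import HarnessLib
import Summits.QuantumFields.YangMills.Theorems.PencilRigidityCurvatureKernelBoundFiniteCouplingStrongTempered
import Summits.QuantumFields.YangMills.Theorems.PencilRigidityCurvatureKernelBoundSwapHankelDecay
import Summits.QuantumFields.YangMills.Theorems.PencilRigidityCurvatureKernelBoundSwapDiagonalVanishing
import Summits.QuantumFields.YangMills.Theorems.PencilRigidityCurvatureKernelBoundSwapOffDiagonalVanishing
import Summits.QuantumFields.YangMills.Theorems.PencilRigidityCurvatureKernelBoundInfiniteVolumeCurvatureClustering
import Summits.QuantumFields.YangMills.Theorems.PencilRigidityCurvatureKernelBoundTorusFiniteSizeRate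

/-!
# `CurvatureKernelBound` — child 2b′ `FiniteCouplingStrongSubextensive`: the strong-coupling disc with renormalisation
# SUB-EXTENSIVE in the lattice size (stub for stmt-QuantumFields-11687, line `coupling-trichotomy`, skeleton v9, lead c10)

Crux `stmt-QuantumFields-11687` (`PencilRigidity.CurvatureKernelBound`). This file PROVES the registered stub
`Stub.FiniteCouplingStrongSubextensive` of skeleton v9: every `W₁`-datum `(r, sch, S₁)` whose couplings converge INTO the inner
strong-coupling disc (`β_k → b`, `|b| < betaOne 4 r.ρ / 4`) and whose plaquette renormalisation is SUB-EXTENSIVE IN THE LATTICE SIZE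
at non-negative coupling — `∀ θ > 0, ∃ᶠ k, 0 ≤ β_k ∧ log c_k² ≤ θ L_k`; this contains every tempered scheme with `β_k ≥ 0` and most
hyper-exponentially renormalised ones — satisfies the conclusion of the crux (`K ≡ κ²`), UNCONDITIONALLY.

Proof (the swap-mirror programme of lead c10; every step is a landed tree theorem of this crux):
1. diagonal subsequence `φ` with `0 ≤ β_{φ j}` and `log c²_{φ j} ≤ L_{φ j}/(j+1)` (`Filter.extraction_forall_of_frequently`) and the
   sub-scheme `sch'` (`exists_subseqScheme_withL`), along which `W₁`'s lattice clause survives and the SUB-EXTENSIVE RATE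
   `c'_k² e^{−κ (L'_k − T/a'_k)} → 0` holds for every `κ > 0`, `T` (because `a'_k L'_k → ∞`);
2. infinite-volume data of the free-boundary strong-coupling state (`InfiniteVolumeCurvatureClustering`: box limits `q`, `P`,
   translation invariance, β-uniform clustering) and the quantitative finite-size rate of the torus states (`TorusFiniteSizeRate`);
3. reflection positivity across the DIAGONAL mirror `x₀ = x₁`, under which the curvature species is exactly covariant: the Hankel
   log-convexity + clustering give the renormalisation-free decay `E_k(u) ≤ E_k(0) e^{−2mu}` (`SwapHankelDecay`), whence the truncated
   renormalised two-point function of the limit VANISHES on every mirror pair (`SwapDiagonalVanishing`: equicontinuity on Schwartz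
   space + strong continuity of translations) and, by Cauchy–Schwarz for the reflection-positive form, on every pair of real bumps
   separated by the mirror (`SwapOffDiagonalVanishing`) — in particular on all axial ball pairs `B̄(∓s e₀, ρ)`, `ρ ≤ s/2`, `s > 0`;
4. hence `S₁ 2 (f₀ ⊗ f₁) = S₁ 1 f₀ · S₁ 1 f₁` there, and lead c9's endgame (`exists_degreeOne_eq_const_mul_realIntegral`,
   `KernelConclusionOfWitnessLocalDecay`) yields the real kernel continuous off `0` with `η = 10`.
[OsterwalderSeiler1978 Thm. 3.5–3.7; FrohlichIsraelLiebSimon1978 Thm. 2.1; OsterwalderSchrader1973 §4.1; folklore]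
-/

noncomputable section

open scoped BigOperators Topology SchwartzMap
open MeasureTheory Filter Set Metric
open Literature.MathematicalPhysics.QuantumLattice Literature.MathematicalPhysics.AQFT
  Literature.MathematicalPhysics.QuantumFieldTheory

namespace Summit.QuantumFields.YangMills.Theorems.CurvatureKernel

/-- **Sub-schemes with all data exposed, including the torus half-sides** (cf. `exists_subseqScheme_full`). [folklore] -/
theorem exists_subseqScheme_withL {G : Type} [Group G] [TopologicalSpace G] [IsTopologicalGroup G]
    [CompactSpace G] [MeasurableSpace G] [BorelSpace G] (r : LatticeRep G)
    (sch : SpeciesScheme (YMSpecies G)) (φ : ℕ → ℕ) (hφ : StrictMono φ) :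
    ∃ sch' : SpeciesScheme (YMSpecies G),
      (∀ (k n : ℕ) (f : Fin n → 𝓢(EuclideanSpace ℝ (Fin 4), ℝ)),
          latticeSchwinger r.ρ sch' (fun s => s.F) k n (fun _ => r.curvature) f =
            latticeSchwinger r.ρ sch (fun s => s.F) (φ k) n (fun _ => r.curvature) f) ∧
        (sch'.β = fun k => sch.β (φ k)) ∧ (sch'.a = fun k => sch.a (φ k)) ∧
        (sch'.c = fun s k => sch.c s (φ k)) ∧ (sch'.L = fun k => sch.L (φ k)) ∧
        ∀ Δ : ℝ, HasLatticeMassGap r sch Δ → HasLatticeMassGap r sch' Δ := by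
  refine ⟨{ a := fun k => sch.a (φ k)
            a_pos := fun k => sch.a_pos (φ k)
            tendsto_a := sch.tendsto_a.comp hφ.tendsto_atTop
            β := fun k => sch.β (φ k)
            L := fun k => sch.L (φ k)
            tendsto_L := sch.tendsto_L.comp hφ.tendsto_atTop
            c := fun s k => sch.c s (φ k)
            m := fun s k => sch.m s (φ k) }, fun _ _ _ => rfl, rfl, rfl, rfl, rfl, ?_⟩
  intro Δ h A B
  obtain ⟨C, hC⟩ := h A B
  exact ⟨C, hφ.tendsto_atTop.eventually hC⟩

/-- **The sub-extensive rate.** If `0 < a_k`, `a_k → 0`, `a_k L_k → ∞` and `log c_k² ≤ L_k / (k + 1)` for all `k`, then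
`c_k² e^{−κ (L_k − T / a_k)} → 0` for every `κ > 0` and every `T`. [folklore] -/
theorem tendsto_sq_mul_exp_of_log_le (a c : ℕ → ℝ) (L : ℕ → ℕ) (ha : ∀ k, 0 < a k)
    (ha0 : Tendsto a atTop (𝓝 0)) (haL : Tendsto (fun k => a k * L k) atTop atTop)
    (hlog : ∀ k, Real.log (c k ^ 2) ≤ (L k : ℝ) / ((k : ℝ) + 1)) (κ T : ℝ) (hκ : 0 < κ) :
    Tendsto (fun k => c k ^ 2 * Real.exp (-(κ * ((L k : ℝ) - T / a k)))) atTop (𝓝 0) := by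
  -- the exponent `L/(k+1) - κ (L - T/a)` tends to `-∞`
  have hexp : Tendsto (fun k : ℕ => (L k : ℝ) / ((k : ℝ) + 1) - κ * ((L k : ℝ) - T / a k)) atTop atBot := by
    -- rewrite as `-( (1/a) * (a L (κ - 1/(k+1)) - κ T) )`
    have h1 : Tendsto (fun k : ℕ => κ - 1 / ((k : ℝ) + 1)) atTop (𝓝 κ) := by
      have : Tendsto (fun k : ℕ => 1 / ((k : ℝ) + 1)) atTop (𝓝 0) := tendsto_one_div_add_atTop_nhds_zero_nat
      simpa using (tendsto_const_nhds (x := κ)).sub this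
    have h2 : Tendsto (fun k : ℕ => a k * L k * (κ - 1 / ((k : ℝ) + 1))) atTop atTop :=
      haL.atTop_mul_pos hκ h1
    have h3 : Tendsto (fun k : ℕ => a k * L k * (κ - 1 / ((k : ℝ) + 1)) - κ * T) atTop atTop :=
      tendsto_atTop_add_const_right _ _ h2
    have h4 : Tendsto (fun k : ℕ => (a k)⁻¹) atTop atTop := by
      have : Tendsto a atTop (𝓝[>] 0) :=
        tendsto_nhdsWithin_iff.2 ⟨ha0, Eventually.of_forall fun k => ha k⟩
      exact tendsto_inv_nhdsGT_zero.comp this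
    have h5 : Tendsto (fun k : ℕ => (a k)⁻¹ * (a k * L k * (κ - 1 / ((k : ℝ) + 1)) - κ * T)) atTop atTop :=
      h4.atTop_mul_atTop₀ h3
    have h6 := tendsto_neg_atTop_atBot.comp h5
    refine h6.congr fun k => ?_
    have hak : (a k) ≠ 0 := (ha k).ne'
    simp only [Function.comp_apply]
    field_simp
    ring
  have hE : Tendsto (fun k : ℕ => Real.exp ((L k : ℝ) / ((k : ℝ) + 1) - κ * ((L k : ℝ) - T / a k))) atTop (𝓝 0) :=
    Real.tendsto_exp_atBot.comp hexp
  -- squeeze: `0 ≤ c² e^{…} ≤ e^{L/(k+1)} e^{…}`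
  refine squeeze_zero (fun k => by positivity) (fun k => ?_) hE
  have hc : c k ^ 2 ≤ Real.exp (Real.log (c k ^ 2)) := by
    by_cases h0 : c k ^ 2 = 0
    · rw [h0]; exact (Real.exp_pos _).le
    · rw [Real.exp_log (lt_of_le_of_ne (sq_nonneg _) (Ne.symm h0))]
  calc c k ^ 2 * Real.exp (-(κ * ((L k : ℝ) - T / a k)))
      ≤ Real.exp ((L k : ℝ) / ((k : ℝ) + 1)) * Real.exp (-(κ * ((L k : ℝ) - T / a k))) := by
        refine mul_le_mul_of_nonneg_right (hc.trans (Real.exp_le_exp.2 (hlog k))) (Real.exp_pos _).le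
    _ = Real.exp ((L k : ℝ) / ((k : ℝ) + 1) - κ * ((L k : ℝ) - T / a k)) := by
        rw [← Real.exp_add]; ring_nf

/-- `|w 0 - w 1| ≤ √2 ‖w‖` on `ℝ⁴`. [folklore] -/
theorem abs_sub_coord_le_sqrt_two_mul_norm (w : EuclideanSpace ℝ (Fin 4)) : |w 0 - w 1| ≤ Real.sqrt 2 * ‖w‖ := by
  have hn : ‖w‖ ^ 2 = ∑ i, (w i) ^ 2 := by
    rw [EuclideanSpace.norm_eq, Real.sq_sqrt (Finset.sum_nonneg fun i _ => sq_nonneg _)]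
    exact Finset.sum_congr rfl fun i _ => by rw [Real.norm_eq_abs, sq_abs]
  have hsum : (w 0) ^ 2 + (w 1) ^ 2 ≤ ‖w‖ ^ 2 := by
    rw [hn]
    have : ∑ i, (w i) ^ 2 = (w 0) ^ 2 + (w 1) ^ 2 + ((w 2) ^ 2 + (w 3) ^ 2) := by
      simp only [Fin.sum_univ_four]; ring
    rw [this]; nlinarith [sq_nonneg (w 2), sq_nonneg (w 3)]
  have h2 : (w 0 - w 1) ^ 2 ≤ 2 * ‖w‖ ^ 2 := by nlinarith [sq_nonneg (w 0 + w 1)]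
  calc |w 0 - w 1| ≤ Real.sqrt (2 * ‖w‖ ^ 2) := Real.abs_le_sqrt h2
    _ = Real.sqrt 2 * ‖w‖ := by rw [Real.sqrt_mul (by norm_num), Real.sqrt_sq (norm_nonneg _)]

/-- **Geometry of the axial balls versus the diagonal mirror `x₀ = x₁`**: `0 < s - √2 ρ` for `ρ ≤ s/2`, the ball `B̄(s e₀, ρ)`
lies in the half-space `{s - √2 ρ ≤ z 0 - z 1}`, the ball `B̄(-s e₀, ρ)` in `{z 0 - z 1 ≤ -(s - √2 ρ)}`, and both lie in
`B̄(0, s + ρ)`. [folklore] -/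
theorem axial_ball_halfspace {s ρ : ℝ} (hs : 0 < s) (hρ : 0 < ρ) (hρs : ρ ≤ s / 2) :
    0 < s - Real.sqrt 2 * ρ ∧
      (∀ z ∈ closedBall (EuclideanSpace.single (0 : Fin 4) s) ρ, s - Real.sqrt 2 * ρ ≤ z 0 - z 1) ∧
      (∀ z ∈ closedBall (EuclideanSpace.single (0 : Fin 4) (-s)) ρ, z 0 - z 1 ≤ -(s - Real.sqrt 2 * ρ)) ∧
      closedBall (EuclideanSpace.single (0 : Fin 4) s) ρ ⊆ closedBall 0 (s + ρ) ∧
      closedBall (EuclideanSpace.single (0 : Fin 4) (-s)) ρ ⊆ closedBall 0 (s + ρ) := by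
  have hsqrt2 : Real.sqrt 2 < 2 := by
    rw [show (2 : ℝ) = Real.sqrt (2 ^ 2) by rw [Real.sqrt_sq (by norm_num)]]
    exact Real.sqrt_lt_sqrt (by norm_num) (by norm_num)
  have h10 : (1 : Fin 4) ≠ 0 := by decide
  refine ⟨by nlinarith [Real.sqrt_nonneg 2], ?_, ?_, ?_, ?_⟩
  · intro z hz
    rw [mem_closedBall, dist_eq_norm] at hz
    have hk := (abs_sub_coord_le_sqrt_two_mul_norm (z - EuclideanSpace.single 0 s)).trans
      (mul_le_mul_of_nonneg_left hz (Real.sqrt_nonneg 2))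
    have e0 : (z - EuclideanSpace.single (0 : Fin 4) s) 0 = z 0 - s := by
      simp
    have e1 : (z - EuclideanSpace.single (0 : Fin 4) s) 1 = z 1 := by
      simp [h10]
    rw [e0, e1] at hk
    have := (abs_le.1 hk).1
    linarith
  · intro z hz
    rw [mem_closedBall, dist_eq_norm] at hz
    have hk := (abs_sub_coord_le_sqrt_two_mul_norm (z - EuclideanSpace.single 0 (-s))).trans
      (mul_le_mul_of_nonneg_left hz (Real.sqrt_nonneg 2))
    have e0 : (z - EuclideanSpace.single (0 : Fin 4) (-s)) 0 = z 0 + s := by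
      simp
    have e1 : (z - EuclideanSpace.single (0 : Fin 4) (-s)) 1 = z 1 := by
      simp [h10]
    rw [e0, e1] at hk
    have := (abs_le.1 hk).2
    linarith
  · intro z hz
    rw [mem_closedBall, dist_eq_norm] at hz
    rw [mem_closedBall, dist_zero_right]
    calc ‖z‖ = ‖(z - EuclideanSpace.single (0 : Fin 4) s) + EuclideanSpace.single (0 : Fin 4) s‖ := by
          rw [sub_add_cancel]
      _ ≤ ‖z - EuclideanSpace.single (0 : Fin 4) s‖ + ‖EuclideanSpace.single (0 : Fin 4) s‖ := norm_add_le _ _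
      _ ≤ ρ + s := by rw [PiLp.norm_single, Real.norm_eq_abs, abs_of_pos hs]; linarith
      _ = s + ρ := by ring
  · intro z hz
    rw [mem_closedBall, dist_eq_norm] at hz
    rw [mem_closedBall, dist_zero_right]
    calc ‖z‖ = ‖(z - EuclideanSpace.single (0 : Fin 4) (-s)) + EuclideanSpace.single (0 : Fin 4) (-s)‖ := by
          rw [sub_add_cancel]
      _ ≤ ‖z - EuclideanSpace.single (0 : Fin 4) (-s)‖ + ‖EuclideanSpace.single (0 : Fin 4) (-s)‖ := norm_add_le _ _
      _ ≤ ρ + s := by rw [PiLp.norm_single, Real.norm_eq_abs, abs_neg, abs_of_pos hs]; linarith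
      _ = s + ρ := by ring

open SemiDegenerate BoundedRenormalisation in
/-- **Stub `FiniteCouplingStrongSubextensive`** (child 2b′ of skeleton v9, registered signature verbatim): on the inner
strong-coupling disc `|b| < betaOne 4 r.ρ / 4`, every `W₁`-datum whose plaquette renormalisation is sub-extensive in the lattice
size at non-negative coupling satisfies the conclusion of the crux. See the module docstring for the proof (lead c10's swap-mirror
programme). [folklore] -/
theorem FiniteCouplingStrongSubextensive : open Literature.MathematicalPhysics.QuantumLattice Literature.MathematicalPhysics.AQFT Literature.MathematicalPhysics.QuantumFieldTheory in ∀ (G : Type) [Group G] [TopologicalSpace G] [IsTopologicalGroup G] [CompactSpace G] [MeasurableSpace G] [BorelSpace G], IsCompactSimpleLieGroup G → ∀ (r : LatticeRep G) (sch : SpeciesScheme (YMSpecies G)) (S₁ : SchwingerFamily (EuclideanSpace ℝ (Fin 4))), ((∀ (n : ℕ), n ≠ 0 → ∀ (f : Fin n → SchwartzMap ((EuclideanSpace ℝ (Fin 4))) ℝ) (F : SchwartzMap (Fin n → (EuclideanSpace ℝ (Fin 4))) ℂ), IsTensorOf F (fun i => ofRealTest (f i)) → IsOffDiagonal F → Filter.Tendsto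 (fun k : ℕ => ((latticeSchwinger r.ρ sch (fun s => s.F) k n (fun _ => r.curvature) f : ℝ) : ℂ)) Filter.atTop (nhds (S₁ n F))) ∧ (S₁.toLabelled.IsNormalized ∧ S₁.toLabelled.IsHermitian ∧ S₁.toLabelled.HasLinearGrowth ∧ S₁.toLabelled.IsReflectionPositive ∧ S₁.toLabelled.IsSymmetric ∧ S₁.toLabelled.HasClusterProperty) ∧ (∀ (n : ℕ) (a : (EuclideanSpace ℝ (Fin 4))) (F : SchwartzMap (Fin n → (EuclideanSpace ℝ (Fin 4))) ℂ), IsOffDiagonal F → S₁ n (translateMulti a F) = S₁ n F) ∧ (∀ (R : (EuclideanSpace ℝ (Fin 4)) ≃ₗᵢ[ℝ] (EuclideanSpace ℝ (Fin 4))), LinearMap.det (R.toLinearEquiv : (EuclideanSpace ℝ (Fin 4)) →ₗ[ℝ] (EuclideanSpace ℝ (Fin 4))) = 1 → (∀ i : Fin 4, ∃ j : Fin 4, R (EuclideanSpace.single i 1) = EuclideanSpace.single j 1 ∨ R (EuclideanSpace.single i 1) = -EuclideanSpace.single j 1) → ∀ (n : ℕ) (F : SchwartzMap (Fin n → (EuclideanSpace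 ℝ (Fin 4))) ℂ), IsOffDiagonal F → S₁ n (linActMulti R F) = S₁ n F) ∧ (∃ Δ : ℝ, 0 < Δ ∧ S₁.toLabelled.HasMassGap Δ ∧ HasLatticeMassGap r sch Δ)) → (∃ b : ℝ, Filter.Tendsto sch.β Filter.atTop (nhds b) ∧ |b| < betaOne 4 r.ρ / 4) → (∀ θ : ℝ, 0 < θ → ∃ᶠ k in Filter.atTop, 0 ≤ sch.β k ∧ Real.log (sch.c r.curvature k ^ 2) ≤ θ * sch.L k) → ∃ (K : (EuclideanSpace ℝ (Fin 4)) → ℝ) (C η : ℝ), 0 < η ∧ ContinuousOn K {x : (EuclideanSpace ℝ (Fin 4)) | x ≠ 0} ∧ (∀ x : (EuclideanSpace ℝ (Fin 4)), x ≠ 0 → |K x| ≤ C * (1 + ‖x‖ ^ (η - 10))) ∧ ∀ F : SchwartzMap (Fin 2 → (EuclideanSpace ℝ (Fin 4))) ℂ, IsOffDiagonal F → MeasureTheory.Integrable (fun x : Fin 2 → (EuclideanSpace ℝ (Fin 4)) => (K (x 0 - x 1) : ℂ) * F x) ∧ S₁ 2 F = ∫ x : Fin 2 → (EuclideanSpace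 ℝ (Fin 4)), (K (x 0 - x 1) : ℂ) * F x := by
  intro G _ _ _ _ _ _ hG r sch S₁ hW₁ hb hsub
  obtain ⟨b, hb, hbβ⟩ := hb
  haveI : T2Space G := (r.continuous.isClosedEmbedding r.injective).isEmbedding.t2Space
  haveI : SecondCountableTopology G :=
    (r.continuous.isClosedEmbedding r.injective).isEmbedding.secondCountableTopology
  -- (1) the diagonal subsequence: `0 ≤ β_{φ j}` and `log c²_{φ j} ≤ L_{φ j} / (j+1)`
  have hfreq : ∀ j : ℕ, ∃ᶠ k in atTop, 0 ≤ sch.β k ∧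
      Real.log (sch.c r.curvature k ^ 2) ≤ (sch.L k : ℝ) / ((j : ℝ) + 1) := by
    intro j
    refine (hsub (1 / ((j : ℝ) + 1)) (by positivity)).mono fun k hk => ⟨hk.1, ?_⟩
    rw [div_eq_inv_mul, ← one_div]; exact hk.2
  obtain ⟨φ, hφ, hφP⟩ := extraction_forall_of_frequently hfreq
  obtain ⟨sch', hls, hβ', ha', hc', hL', hgap'⟩ := exists_subseqScheme_withL r sch φ hφ
  obtain ⟨hconv, hpkg, htr, hhyp, Δ, hΔ, hgap, hlat⟩ := id hW₁
  have hconv' : ∀ (n : ℕ), n ≠ 0 → ∀ (f : Fin n → 𝓢(EuclideanSpace ℝ (Fin 4), ℝ))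
      (F : 𝓢((Fin n → EuclideanSpace ℝ (Fin 4)), ℂ)), IsTensorOf F (fun i => ofRealTest (f i)) → IsOffDiagonal F →
      Tendsto (fun k : ℕ => ((latticeSchwinger r.ρ sch' (fun s => s.F) k n (fun _ => r.curvature) f : ℝ) : ℂ))
        atTop (𝓝 (S₁ n F)) := by
    intro n hn f F hF hoff
    refine ((hconv n hn f F hF hoff).comp hφ.tendsto_atTop).congr (fun k => ?_)
    simp only [Function.comp_apply, hls]
  -- the scheme data of `sch'`
  have h0' : ∀ k, 0 ≤ sch'.β k := fun k => by rw [hβ']; exact (hφP k).1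
  have hlog' : ∀ k, Real.log (sch'.c r.curvature k ^ 2) ≤ (sch'.L k : ℝ) / ((k : ℝ) + 1) := fun k => by
    rw [hc', hL']; exact (hφP k).2
  -- (2) the closed disc `0 ≤ β ≤ β''`, `|b| < β'' < betaOne/4`, eventually containing the couplings of `sch'`
  set β₀ : ℝ := betaOne 4 r.ρ / 4 with hβ₀def
  set β'' : ℝ := (|b| + β₀) / 2 with hβ''def
  have hb0 : 0 ≤ |b| := abs_nonneg b
  have hβ''0 : 0 < β'' := by rw [hβ''def]; linarith
  have hβ''1 : β'' < betaOne 4 r.ρ / 4 := by rw [hβ''def]; linarith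
  have hbβ'' : |b| < β'' := by rw [hβ''def]; linarith
  have hev : ∀ᶠ k in atTop, sch'.β k ≤ β'' := by
    have h1 : Tendsto sch'.β atTop (𝓝 b) := by rw [hβ']; exact hb.comp hφ.tendsto_atTop
    exact (h1.eventually (Iic_mem_nhds ((le_abs_self b).trans_lt hbβ''))).mono fun k hk => hk
  -- the sub-extensive rate along `sch'`
  have hrate : ∀ κ T : ℝ, 0 < κ → Tendsto (fun k : ℕ => sch'.c r.curvature k ^ 2 *
      Real.exp (-(κ * ((sch'.L k : ℝ) - T / sch'.a k)))) atTop (𝓝 0) := fun κ T hκ =>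
    tendsto_sq_mul_exp_of_log_le sch'.a (sch'.c r.curvature) sch'.L sch'.a_pos sch'.tendsto_a sch'.tendsto_L
      hlog' κ T hκ
  -- (3) infinite-volume data and the finite-size rate
  obtain ⟨m, A, q, P, hm, hF5⟩ := InfiniteVolumeCurvatureClustering r.N G r.ρ r.continuous r.curvature.F
    ⟨_, r.curvature.isCylinder⟩ r.curvature.measurable r.curvature.bounded β'' hβ''0 hβ''1
  obtain ⟨μ', hμ', hAfs⟩ := TorusFiniteSizeRate r.N G r.ρ r.continuous
  choose Afs hAfs using hAfs
  -- (4) vanishing on mirror pairs (decay from `SwapHankelDecay`, endgame `SwapDiagonalVanishing`)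
  have hA : ∀ (δ T : ℝ) (g gθ : 𝓢(EuclideanSpace ℝ (Fin 4), ℝ)), 0 < δ → 0 < T →
      (∀ z ∈ tsupport (g : EuclideanSpace ℝ (Fin 4) → ℝ), δ ≤ z 0 - z 1) →
      tsupport (g : EuclideanSpace ℝ (Fin 4) → ℝ) ⊆ closedBall 0 T →
      (∀ z : EuclideanSpace ℝ (Fin 4), gθ z = g (WithLp.toLp 2 (fun i => z (Equiv.swap (0 : Fin 4) 1 i)))) →
      Tendsto (fun k : ℕ => latticeSchwinger r.ρ sch' (fun s => s.F) k 2 (fun _ => r.curvature) ![gθ, g] -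
        latticeSchwinger r.ρ sch' (fun s => s.F) k 1 (fun _ => r.curvature) (fun _ => gθ) *
          latticeSchwinger r.ρ sch' (fun s => s.F) k 1 (fun _ => r.curvature) (fun _ => g)) atTop (𝓝 0) := by
    intro δ T g gθ hδ hT hg hgT hθ
    refine SwapDiagonalVanishing G r sch' S₁ hconv' β'' hβ''0 hβ''1 h0' hev hrate m A q P hm hF5 μ' Afs hμ' hAfs
      δ T g gθ hδ hT hg hgT hθ ?_
    have hea : ∀ᶠ k in atTop, sch'.a k ≤ δ := sch'.tendsto_a.eventually (Iic_mem_nhds hδ)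
    filter_upwards [hev, hea] with k hk hka u
    exact (SwapHankelDecay G r β'' m A q P hβ''0 hβ''1 hm hF5 (sch'.β k) (h0' k) hk (sch'.L k) (sch'.a k) δ
      (sch'.a_pos k) hka g gθ hg hθ u).2
  -- (5) vanishing on mirror-separated pairs (`SwapOffDiagonalVanishing`), hence factorisation on ALL axial ball pairs
  have hB := SwapOffDiagonalVanishing G r sch' β'' hβ''0 hβ''1 h0' hev hrate m A q P hm hF5 μ' Afs hμ' hAfs hA
  have hfar : ∀ (s ρ : ℝ), 0 < s → 0 < ρ → ρ ≤ s / 2 →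
      ∀ (f : Fin 2 → 𝓢(EuclideanSpace ℝ (Fin 4), ℝ)) (F : 𝓢((Fin 2 → EuclideanSpace ℝ (Fin 4)), ℂ))
        (F₀ F₁ : 𝓢((Fin 1 → EuclideanSpace ℝ (Fin 4)), ℂ)), IsTensorOf F (fun i => ofRealTest (f i)) →
        IsTensorOf F₀ (fun _ => ofRealTest (f 0)) → IsTensorOf F₁ (fun _ => ofRealTest (f 1)) →
        tsupport ((f 0 : 𝓢(EuclideanSpace ℝ (Fin 4), ℝ)) : EuclideanSpace ℝ (Fin 4) → ℝ) ⊆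
          closedBall (EuclideanSpace.single (0 : Fin 4) (-s)) ρ →
        tsupport ((f 1 : 𝓢(EuclideanSpace ℝ (Fin 4), ℝ)) : EuclideanSpace ℝ (Fin 4) → ℝ) ⊆
          closedBall (EuclideanSpace.single (0 : Fin 4) s) ρ →
        S₁ 2 F = S₁ 1 F₀ * S₁ 1 F₁ := by
    intro s ρ hs hρ hρs f F F₀ F₁ hF hF₀ hF₁ h0 h1
    obtain ⟨hδ, hpos, hneg, hballp, hballm⟩ := axial_ball_halfspace hs hρ hρs
    have hsρ : 0 < s + ρ := by linarith
    have ht := hB (s - Real.sqrt 2 * ρ) (s + ρ) (f 0) (f 1) hδ hsρ (fun z hz => hneg z (h0 hz))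
      (fun z hz => hpos z (h1 hz)) (h0.trans hballm) (h1.trans hballp)
    have hf : ![f 0, f 1] = f := by
      funext i; fin_cases i <;> rfl
    rw [hf] at ht
    have hFoff : IsOffDiagonal F :=
      isOffDiagonal_of_isTensorOf_of_disjoint hF ((disjoint_closedBall_single hs hρs).mono h0 h1)
    have hu := hconv' 2 two_ne_zero f F hF hFoff
    have hv := hconv' 1 one_ne_zero (fun _ => f 0) F₀ hF₀ (HypercubicLimit.Negative.isOffDiagonal_fin_one F₀)
    have hw := hconv' 1 one_ne_zero (fun _ => f 1) F₁ hF₁ (HypercubicLimit.Negative.isOffDiagonal_fin_one F₁)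
    have ht' : Tendsto (fun k : ℕ =>
        ((latticeSchwinger r.ρ sch' (fun s => s.F) k 2 (fun _ => r.curvature) f : ℝ) : ℂ) -
          ((latticeSchwinger r.ρ sch' (fun s => s.F) k 1 (fun _ => r.curvature) (fun _ => f 0) : ℝ) : ℂ) *
            ((latticeSchwinger r.ρ sch' (fun s => s.F) k 1 (fun _ => r.curvature) (fun _ => f 1) : ℝ) : ℂ))
        atTop (𝓝 0) := by
      have h := (Complex.continuous_ofReal.tendsto 0).comp ht
      rw [Complex.ofReal_zero] at h
      refine h.congr fun k => ?_
      simp only [Function.comp_apply, Complex.ofReal_sub, Complex.ofReal_mul]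
    have hZ : S₁ 2 F - S₁ 1 F₀ * S₁ 1 F₁ = 0 := tendsto_nhds_unique (hu.sub (hv.mul hw)) ht'
    exact sub_eq_zero.1 hZ
  -- (6) two-point LOCAL DECAY with `η = 10`, `A = ‖κ‖²`, `B = 0`, and the kernel conclusion
  obtain ⟨κ, hκ⟩ := exists_degreeOne_eq_const_mul_realIntegral S₁ htr
  refine KernelConclusionOfWitnessLocalDecay G hG r sch S₁ hW₁ ⟨‖κ‖ ^ 2, 10, 1, by norm_num, one_pos, ?_⟩
  intro s hs _
  refine ⟨s / 2, ‖κ‖ ^ 2, 0, half_pos hs, sq_nonneg _, le_rfl, ?_, ?_⟩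
  · rw [sub_self, Real.rpow_zero, mul_one, add_zero]
  · intro ρ hρ hρs f F M₀ M₁ hF h0 h1 _ _
    obtain ⟨F₀, hF₀⟩ := exists_isTensorOf (n := 1) (fun _ : Fin 1 => ofRealTest (f 0))
    obtain ⟨F₁, hF₁⟩ := exists_isTensorOf (n := 1) (fun _ : Fin 1 => ofRealTest (f 1))
    have hZ := hfar s ρ hs hρ hρs f F F₀ F₁ hF hF₀ hF₁ h0 h1
    rw [hZ, hκ (f 0) F₀ hF₀, hκ (f 1) F₁ hF₁]
    calc ‖κ * ((∫ x : EuclideanSpace ℝ (Fin 4), f 0 x : ℝ) : ℂ) *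
          (κ * ((∫ x : EuclideanSpace ℝ (Fin 4), f 1 x : ℝ) : ℂ))‖
        ≤ ‖κ‖ ^ 2 * (∫ x : EuclideanSpace ℝ (Fin 4), |f 0 x|) * (∫ x : EuclideanSpace ℝ (Fin 4), |f 1 x|) :=
          norm_disconnected_le κ f
      _ = ‖κ‖ ^ 2 * (∫ x : EuclideanSpace ℝ (Fin 4), |f 0 x|) * (∫ x : EuclideanSpace ℝ (Fin 4), |f 1 x|) +
          0 * ρ ^ 8 * M₀ * M₁ := by ring

end Summit.QuantumFields.YangMills.Theorems.CurvatureKernel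

end
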